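import Summits.BirchSwinnertonDyer.BirchSwinnertonDyer.Theorems.SmallImageMuTransferMuTransferX9RedTowerUnramified
import Literature.NumberTheory.EllipticCurves.Kato2004.EulerSystemBoundFineSelmerTwo
import Literature.NumberTheory.EllipticCurves.CyclotomicZpExtensionLayerTwoProofs
import HarnessLib

/-!
# Route ByReductionTypeAtTwo, crux `OrdKatoHalfAtTwoIso` (stmt-BirchSwinnertonDyer-19573), line `steinberg-fibre-at-two`,
# registered stub `stub_HK_kolyvaginRankOneTwo` (Ω2 = H-K), interior step (I0)₂: the Euler-system tower class of a
# GENUINE `2`-ADIC class (`IsEulerSystemClassTwo`) is UNRAMIFIED at every `q ∤ 2` where `E[2]` is unramified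

Seat `cruxlead-stmt-BirchSwinnertonDyer-19573-g0` (LEAD PROVER, MODE LINE; HOME `run/shared/lean/pub/bsd-2adic/`).
THEOREMS ONLY. HONEST FRAMING (cell bsd-2adic): BSD is not proved by any of this; the crux is not proved;
`--supports` helper toward the lead's registered research stub `stub_HK_kolyvaginRankOneTwo : KolyvaginRankOneTwo`
(skeleton v6), closing nothing. VERBATIM `p = 2` twin of x9's `…X9RedTowerUnramified.lean` (`RedTower.proj_mem_integralH1`,
`exists_cocycle_reduceH1_proj_apply_eq_zero`, `localization_redTower_mem_unramifiedSubgroup`,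
`forall_absInertia_apply_eq_zero_of_oneCocycleClass_eq_redTower`) over `Kato2004.IsEulerSystemClassTwo` (levels
`ℚ(μ_{2^{n+2}})`, corestriction `levelToLayerTwo` along `IsCyclotomic.cyclotomicLevelsRat_level_le_layerSubgroup_two`)
instead of `IsEulerSystemClass` (levels `ℚ(μ_{p^{n+1}})`, `coresToLayer`). Only the first theorem touches the
Euler-system structure; the other three are copied with the new hypothesis. Consumed by the package / pair transport
of H-K as clause (I0) and as `hΦI`.

References: K. Kato, Astérisque 295 (2004) (8.1.3), §8.2, Lemma 8.5, §13.8 [Kato2004Asterisque]; J.-P. Serre,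
*Galois Cohomology* (1997) I §2.5 [SerreGaloisCohomology1997]; L. Washington, *Introduction to Cyclotomic Fields* §13.1
[Washington1997].
-/

set_option linter.dupNamespace false
set_option autoImplicit false

noncomputable section

open CategoryTheory Function
open scoped NumberField Pointwise
open Field IsDedekindDomain NumberField
open Literature.NumberTheory.GaloisRepresentations
open Literature.NumberTheory.GaloisRepresentations.IsNonarchimedeanLocalField
open Literature.NumberTheory.EllipticCurves
open Literature.NumberTheory.EllipticCurves.ZpExtension
open Literature.NumberTheory.EllipticCurves.Kato2004
open Literature.NumberTheory.EllipticCurves.Kato2004.EulerSystemValues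
open Rat.HeightOneSpectrum
open Summit.BirchSwinnertonDyer.BirchSwinnertonDyer.Rank1Residual

namespace Summit.BirchSwinnertonDyer.BirchSwinnertonDyer.Theorems.SteinbergFibreAtTwo.RedTowerTwo

variable (W : WeierstrassCurve ℚ) [W.IsElliptic]
  [ContinuousSMul ℤ_[2] (W.tateModule 2)]
  [Module.Free ℤ_[2] (W.tateModule 2)] [Module.Finite ℤ_[2] (W.tateModule 2)]
  (κ : ZpExtension ℚ 2) (hκ : κ.IsCyclotomic) (γ : absoluteGaloisGroup ℚ) (I : IwasawaH1Data W 2 κ γ)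

/-- **The layer components of a genuine `2`-adic Euler-system class are integral**: `proj_n s =
Cor_{ℚ(μ_{2^{n+2}}) → ℚ_n} (z_{n+2,∅})` lies in `integralH1` (Kato (8.1.3): the classes `z` are integral; the trace
keeps integrality, `Kato2004.coresLe_mem_integralH1`, since `ℚ(μ_{2^{n+2}})/ℚ` is unramified away from `2`). The
`p = 2` twin of `RedTower.proj_mem_integralH1`. [cite: Kato2004Asterisque, (8.1.3), §8.2 and Lemma 8.5 (pp. 180–184)] -/
theorem proj_mem_integralH1 {s : I.H} (hES : IsEulerSystemClassTwo W hκ I s) (n : ℕ) :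
    I.proj n s ∈ integralH1 (tateRep W 2) 2 (κ.layerSubgroup n) := by
  haveI : Fact (2 : ℕ).Prime := ⟨Nat.prime_two⟩
  obtain ⟨S, hS, z, -, hint, hproj⟩ := hES
  rw [hproj n]
  haveI := normal_cyclotomicLevelsRat_level_empty 2 S (n + 2)
  haveI : ((cyclotomicLevelsRat 2 S).level (n + 2) ∅).FiniteIndex :=
    finiteIndex_of_isOpen_of_compactSpace _ ((cyclotomicLevelsRat 2 S).isOpen_level (n + 2) ∅)
  letI : Fintype (κ.layerSubgroup n ⧸
      ((cyclotomicLevelsRat 2 S).level (n + 2) ∅).subgroupOf (κ.layerSubgroup n)) :=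
    Fintype.ofFinite _
  have key := Kato2004.coresLe_mem_integralH1 (tateRep W 2) 2
    (hκ.cyclotomicLevelsRat_level_le_layerSubgroup_two S n)
    ((cyclotomicLevelsRat 2 S).isOpen_level (n + 2) ∅)
    (cyclotomicLevelsRat_level_empty_unramifiedAt 2 S (n + 2))
    (hint (n + 2) (cyclotomicLevelsRat 2 S).idealOne)
  convert key using 2
  delta levelToLayerTwo
  rfl

/-- **A cocycle of `red (proj_n s) ∈ H¹(ℚ_n, E[2])` vanishing on `Γ_n ∩ I_𝔓` for every `𝔓 ∣ q`**, `q ∤ 2`, `E[2]`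
unramified at `q` (the reduction of an integral class is integral; a class vanishing on `Γ_n ∩ I_𝔓` with `I_𝔓`
acting trivially has every cocycle vanishing there). Twin of `RedTower.exists_cocycle_reduceH1_proj_apply_eq_zero`.
[cite: Kato2004Asterisque, §8.2 and Lemma 8.5 (pp. 180–184)] -/
theorem exists_cocycle_reduceH1_proj_apply_eq_zero {s : I.H} (hES : IsEulerSystemClassTwo W hκ I s)
    (n : ℕ) {q : HeightOneSpectrum (𝓞 ℚ)} (hqp : ((2 : ℕ) : 𝓞 ℚ) ∉ q.asIdeal)
    (hur : GaloisRep.IsUnramifiedAt q (W.torsionGaloisModule ((2 : ℕ) : ℤ))) :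
    ∃ f : contOneCocycles
        (subgroupRep (W.torsionGaloisModule ((2 : ℕ) : ℤ)).toTopRep (κ.layerSubgroup n)),
      oneCocycleClass _ f = reduceH1 W 2 (κ.layerSubgroup n) (I.proj n s) ∧
      ∀ 𝔓 ∈ q.primesAbove, ∀ g : κ.layerSubgroup n,
        (g : absoluteGaloisGroup ℚ) ∈ 𝔓.inertia (absoluteGaloisGroup ℚ) → f.1 g = 0 := by
  haveI : Fact (2 : ℕ).Prime := ⟨Nat.prime_two⟩
  have hint := reduceH1_mem_integralH1 W 2 (κ.layerSubgroup n) (proj_mem_integralH1 W κ hκ γ I hES n)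
  obtain ⟨f, hf⟩ := oneCocycleClass_surjective _ (reduceH1 W 2 (κ.layerSubgroup n) (I.proj n s))
  refine ⟨f, hf, fun 𝔓 h𝔓 g hg => ?_⟩
  have hne : ((primesEquiv q : Nat.Primes) : ℕ) ≠ 2 := by
    intro h
    apply hqp
    rw [Rat.natCast_mem_asIdeal_iff, ← h]
    exact dvd_rfl
  have hres := (mem_integralH1_iff _ 2 _ _).1 hint q hne 𝔓 h𝔓
  rw [← hf] at hres
  have hI : ∀ τ ∈ 𝔓.inertia (absoluteGaloisGroup ℚ), ∀ w : (W.torsionGaloisModule ((2 : ℕ) : ℤ)).toTopRep,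
      (W.torsionGaloisModule ((2 : ℕ) : ℤ)).toTopRep.ρ τ w = w := fun τ hτ w => by
    change (W.torsionGaloisModule ((2 : ℕ) : ℤ)) τ w = w
    rw [hur 𝔓 h𝔓 τ hτ]
    rfl
  exact KolyvaginTwist.apply_eq_zero_of_resLe_inf_eq_zero _ _ (𝔓.inertia (absoluteGaloisGroup ℚ)) hI
    f hres g hg

/-- **(I0)₂ — the tower class of a genuine `2`-adic Euler-system class is unramified at `q`.** For every level `J`
and every finite place `q ∤ 2` where `E[2]` is unramified: `loc_q ((I.redTower s)_J) ∈ H¹_ur(ℚ_q, 𝒯_J(E))`. Twin of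
`RedTower.localization_redTower_mem_unramifiedSubgroup`. [cite: Kato2004Asterisque, (8.1.3) and §13.8 (pp. 228–229)]
[cite: SerreGaloisCohomology1997, I §2.5 Prop. 10] -/
theorem localization_redTower_mem_unramifiedSubgroup {s : I.H}
    (hES : IsEulerSystemClassTwo W hκ I s)
    {q : HeightOneSpectrum (𝓞 ℚ)} (hqp : ((2 : ℕ) : 𝓞 ℚ) ∉ q.asIdeal)
    (hur : GaloisRep.IsUnramifiedAt q (W.torsionGaloisModule ((2 : ℕ) : ℤ))) (J : ℕ) :
    galoisCohomology.localization (W.modPTwist 2 κ J) (Sum.inr q) 1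
        ((I.redTower s : ∀ J : ℕ, galoisCohomology (κ.twistModP (W.torsionGaloisModule ((2 : ℕ) : ℤ))
          IwasawaH1Data.torsion_nsmul_eq_zero J) 1) J) ∈
      DiscreteGaloisModule.unramifiedSubgroup (GaloisRep.toLocal q (W.modPTwist 2 κ J)) 1 := by
  haveI : Fact (2 : ℕ).Prime := ⟨Nat.prime_two⟩
  letI := κ.fintypeQuotientLayer J
  obtain ⟨f, hf, hf0⟩ := exists_cocycle_reduceH1_proj_apply_eq_zero W κ hκ γ I hES J hqp hur
  obtain ⟨F, hF, hF0⟩ :=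
    CoresUnramified.exists_cocycle_coresShapiro_apply_eq_zero_of_forall_primesAbove κ
      (W.torsionGaloisModule ((2 : ℕ) : ℤ)) IwasawaH1Data.torsion_nsmul_eq_zero J hqp f hf0
  have hJ : J ≤ 2 ^ J := (Nat.lt_pow_self (Fact.out : (2 : ℕ).Prime).one_lt).le
  have hred : (I.redTower s : ∀ J : ℕ, galoisCohomology (κ.twistModP (W.torsionGaloisModule ((2 : ℕ) : ℤ))
      IwasawaH1Data.torsion_nsmul_eq_zero J) 1) J =
      oneCocycleClass _ (κ.pushCocycle (W.torsionGaloisModule ((2 : ℕ) : ℤ))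
        IwasawaH1Data.torsion_nsmul_eq_zero (2 ^ J)
        (κ.twistModPTruncate (W.torsionGaloisModule ((2 : ℕ) : ℤ)) IwasawaH1Data.torsion_nsmul_eq_zero
          (2 ^ J) hJ) F) := by
    rw [IwasawaH1Data.redTower_apply_coe, ← hf, ← hF]
    exact map_oneCocycleClass_twist κ _ _ _ _ F
  rw [hred]
  exact KolyvaginTwist.localization_mem_unramifiedSubgroup_of_forall_inertia_apply_eq_zero
    (W.modPTwist 2 κ J) q _ fun τ hτ => by
      rw [pushCocycle_apply, hF0 _ (adicCompletionPrime_mem_primesAbove ℚ q) τ hτ, map_zero]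

/-- **Pointwise form for any cocycle of `(I.redTower s)_J` at `p = 2`** (the H-K cocycle `Φ' = S^a ∘ Φ`): it vanishes
on the restricted local inertia `res(I_{ℚ_q})` — the hypothesis `hΦI` of the pair transport. Twin of
`RedTower.forall_absInertia_apply_eq_zero_of_oneCocycleClass_eq_redTower`.
[cite: Kato2004Asterisque, (8.1.3) and §13.8 (pp. 228–229)] [cite: SerreGaloisCohomology1997, I §2.5 Prop. 10] -/
theorem forall_absInertia_apply_eq_zero_of_oneCocycleClass_eq_redTower {s : I.H}
    (hES : IsEulerSystemClassTwo W hκ I s) {q : HeightOneSpectrum (𝓞 ℚ)}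
    (hqp : ((2 : ℕ) : 𝓞 ℚ) ∉ q.asIdeal) (hur : GaloisRep.IsUnramifiedAt q (W.torsionGaloisModule ((2 : ℕ) : ℤ)))
    (J : ℕ) (Φ' : contOneCocycles (W.modPTwist 2 κ J).toTopRep)
    (hΦ' : oneCocycleClass (W.modPTwist 2 κ J).toTopRep Φ' =
      (I.redTower s : ∀ J : ℕ, galoisCohomology (κ.twistModP (W.torsionGaloisModule ((2 : ℕ) : ℤ))
        IwasawaH1Data.torsion_nsmul_eq_zero J) 1) J) :
    ∀ i ∈ absInertia (q.adicCompletion ℚ),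
      Φ'.1 (absGaloisRestrict ℚ (q.adicCompletion ℚ) i) = 0 := by
  haveI : Fact (2 : ℕ).Prime := ⟨Nat.prime_two⟩
  have hmem := localization_redTower_mem_unramifiedSubgroup W κ hκ γ I hES hqp hur J
  rw [← hΦ'] at hmem
  exact fun i hi => StepFour.apply_absGaloisRestrict_eq_zero_of_localization_mem_unramified κ
    (W.torsionGaloisModule ((2 : ℕ) : ℤ)) (fun P => AddSubgroup.torsionBy.nsmul P) J q hur hqp Φ' hmem hi

end Summit.BirchSwinnertonDyer.BirchSwinnertonDyer.Theorems.SteinbergFibreAtTwo.RedTowerTwo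

end
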